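import Summits.ResolutionOfSingularities.ResolutionOfSingularities.Theorems.HomologicalConductorNoZenoStrictTransformM
import Summits.ResolutionOfSingularities.ResolutionOfSingularities.Theorems.HomologicalConductorNoZenoExcCurvesBaseChange
import Summits.ResolutionOfSingularities.ResolutionOfSingularities.Theorems.HomologicalConductorSurfaceTerminationGenusCover
import Literature.AlgebraicGeometry.Resolution.ExceptionalCurvePoints
import Literature.AlgebraicGeometry.Resolution.PrimeDivisorIdeals
import Literature.AlgebraicGeometry.Resolution.AlterationsResolution
import HarnessLib

/-!
# Crux `NoZenoR` / `NoZeno` (stmt-ResolutionOfSingularities-19943 / -16483) — slot 5 (B1) closer, ROUTE M (m1): EXCEPTIONAL CURVES OF A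
# DOMINATED RESOLUTION LIFT ALONG THE DOMINATION, with isomorphic local rings

Route `ResolutionOfSingularities/HomologicalConductor`, W4.4 chain, slot 5 `stub_L1wCoreF3`; res-L0-w44-lead-1 g9 RE-CUT of seam 2
«ROUTE M: minimal model dominated by the germ resolution» (STATUS 20:38:37Z), NEW ASK (LIFT): for resolutions `ψ = h ≫ π_m` and `π_m`
of `Spec S` (`S` a Noetherian local domain of Krull dimension `2`) every exceptional curve of `π_m` LIFTS: `∀ η ∈ excCurvePoints π_m,
∃ y ∈ excCurvePoints (h ≫ π_m), h y = η`, and `h` is a local isomorphism at `y` (hand res-L0-w44-stub-3 g14).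

PROOF (topology + one valuation-ring step, all by name): `h` is proper (`IsProper.of_comp`, `π_m` separated) and birational
(`GenusDescent.isBirational_of_comp'`), hence dominant with closed range, hence SURJECTIVE; any `y` over `η` lies over the closed point
and `1 = height η ≤ height y` (`height_apply_le_of_isClosedMap`, p540696) `≤ 1` (`IsResolution.height_le_one_of_base_eq_closedPoint`,
the resolution `ψ` of the two-dimensional `S`); and `𝒪_{Y,η}` is a discrete valuation ring (regular of codimension one,
`isPrincipalIdealRing_stalk_of_coheight_eq_one`), so `h.stalkMap y` is bijective (res-D-pv-045 `stalkMap_bijective_of_isBirational`,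
p565927).  Def-free, fact-free; `--supports 19943 --as helper`.  OURS (cell res-hironaka): AI-produced and kernel-checked, weaker than
expert review; nothing here is a statement of the manuscript under review (Hironaka 2017); counted 0.
-/

noncomputable section

-- single-problem summit: the doubled namespace component `ResolutionOfSingularities` is forced
set_option linter.dupNamespace false

open CategoryTheory AlgebraicGeometry TopologicalSpace IsLocalRing
open Literature.AlgebraicGeometry.Resolution Literature.AlgebraicGeometry.Motives

namespace Summit.ResolutionOfSingularities.ResolutionOfSingularities.Theorems.NoZeno.ExcCount

section Lift

variable {S : Type} [CommRing S] [IsNoetherianRing S] [IsLocalRing S] [IsDomain S]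
  {W Y : Scheme.{0}} [IsIntegral W] [IsIntegral Y] (πm : Y ⟶ Spec (.of S)) (h : W ⟶ Y)

omit [IsIntegral W] [IsIntegral Y] in
/-- **A proper dominant morphism is surjective** (closed dense range). [folklore] -/
theorem surjective_of_isProper_of_isDominant [IsProper h] [IsDominant h] : Function.Surjective h.base := by
  have hcl : IsClosed (Set.range h.base) := h.isClosedMap.isClosed_range
  have hd : Dense (Set.range h.base) := h.denseRange
  rw [← Set.range_eq_univ]
  exact hd.closure_eq ▸ hcl.closure_eq.symm ▸ rfl

omit [IsNoetherianRing S] [IsLocalRing S] [IsDomain S] in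
/-- A factor of a resolution through a resolution is proper and birational (hence dominant): for `ψ = h ≫ π_m` with `ψ`, `π_m`
resolutions, `h` is proper (`IsProper.of_comp`) and birational (`GenusDescent.isBirational_of_comp'`). OURS. [folklore] -/
theorem isProper_and_isBirational_of_comp (hψ : IsResolution (h ≫ πm)) (hπ : IsResolution πm) :
    IsProper h ∧ IsBirational h := by
  haveI : IsProper (h ≫ πm) := hψ.isProper
  haveI : IsProper πm := hπ.isProper
  exact ⟨IsProper.of_comp h πm, SurfaceTermination.GenusDescent.isBirational_of_comp' hπ.isBirational hψ.isBirational⟩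

/-- **(LIFT) Exceptional curves of the dominated resolution lift.**  Let `S` be a Noetherian local domain of Krull dimension `2`,
`π_m : Y → Spec S` and `ψ = h ≫ π_m : W → Spec S` resolutions (so `h : W → Y` is proper birational).  Then every integral
exceptional curve of `π_m` is the image of an integral exceptional curve of `ψ`: for `η ∈ excCurvePoints π_m` there is
`y ∈ excCurvePoints (h ≫ π_m)` with `h y = η` (any point over `η` will do: `h` is surjective, heights can only drop under the closed
map `h`, and points of `W` over the closed point have height `≤ 1`). (res-L0-w44-lead-1 ROUTE M (m1).) OURS. [folklore] -/
theorem exists_mem_excCurvePoints_apply_eq (h2 : ringKrullDim S = 2) (hψ : IsResolution (h ≫ πm))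
    (hπ : IsResolution πm) {η : Y} (hη : η ∈ excCurvePoints πm) :
    ∃ y ∈ excCurvePoints (h ≫ πm), h.base y = η := by
  obtain ⟨hprop, hbir⟩ := isProper_and_isBirational_of_comp πm h hψ hπ
  haveI := hprop
  haveI : IsDominant h := hbir.isDominant
  obtain ⟨y, hy⟩ := surjective_of_isProper_of_isDominant h η
  refine ⟨y, ⟨?_, le_antisymm ?_ ?_⟩, hy⟩
  · -- over the closed point
    change πm.base (h.base y) = closedPoint S
    rw [hy]
    exact hη.1
  · -- height `≤ 1`: `ψ` resolves the two-dimensional `S`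
    refine hψ.height_le_one_of_base_eq_closedPoint h2 ?_
    change πm.base (h.base y) = closedPoint S
    rw [hy]
    exact hη.1
  · -- height `≥ 1`: heights drop under the closed map `h`
    have := height_apply_le_of_isClosedMap h h.isClosedMap y
    rw [hy, hη.2] at this
    exact this

/-- **(LIFT) with the local isomorphism.**  In the situation of `exists_mem_excCurvePoints_apply_eq`, at ANY point `y` of `W` over an
exceptional-curve point `η` of the regular `Y` the stalk map `h.stalkMap y : 𝒪_{Y,η} → 𝒪_{W,y}` is BIJECTIVE — `𝒪_{Y,η}` is a discrete
valuation ring (regular of codimension one, `isPrincipalIdealRing_stalk_of_coheight_eq_one`) and a birational morphism is a local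
isomorphism under a valuation ring (`stalkMap_bijective_of_isBirational`, res-D-pv-045); in particular the residue fields of `y` and
`η` are identified. OURS. [folklore] -/
theorem stalkMap_bijective_of_apply_mem_excCurvePoints (h2 : ringKrullDim S = 2) (hψ : IsResolution (h ≫ πm))
    (hπ : IsResolution πm) {y : W} (hy : h.base y ∈ excCurvePoints πm) :
    Function.Bijective (h.stalkMap y) := by
  obtain ⟨hprop, hbir⟩ := isProper_and_isBirational_of_comp πm h hψ hπ
  haveI : IsDominant h := hbir.isDominant
  have hcoh : Order.coheight (h.base y) = 1 := IsResolution.coheight_eq_one_of_mem_excCurvePoints h2 hπ hy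
  haveI : IsPrincipalIdealRing (Y.presheaf.stalk (h.base y)) :=
    isPrincipalIdealRing_stalk_of_coheight_eq_one hπ.isRegular hcoh
  haveI : ValuationRing (Y.presheaf.stalk (h.base y)) := inferInstance
  exact stalkMap_bijective_of_isBirational h hbir y

/-- **(LIFT), bundled**: `∀ η ∈ excCurvePoints π_m, ∃ y ∈ excCurvePoints (h ≫ π_m), h y = η ∧ h.stalkMap y bijective`.
(res-L0-w44-lead-1 ROUTE M (m1), by name.) OURS. [folklore] -/
theorem exists_mem_excCurvePoints_apply_eq_and_bijective (h2 : ringKrullDim S = 2)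
    (hψ : IsResolution (h ≫ πm)) (hπ : IsResolution πm) {η : Y} (hη : η ∈ excCurvePoints πm) :
    ∃ y ∈ excCurvePoints (h ≫ πm), h.base y = η ∧ Function.Bijective (h.stalkMap y) := by
  obtain ⟨y, hy, hyη⟩ := exists_mem_excCurvePoints_apply_eq πm h h2 hψ hπ hη
  exact ⟨y, hy, hyη, stalkMap_bijective_of_apply_mem_excCurvePoints πm h h2 hψ hπ (hyη ▸ hη)⟩

end Lift

end Summit.ResolutionOfSingularities.ResolutionOfSingularities.Theorems.NoZeno.ExcCount

end
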